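import Literature.NumberTheory.Automorphic.EichlerOrderAtkinLehnerIdeal
import Literature.NumberTheory.Automorphic.QuaternionLocalSplitIdealCount
import HarnessLib

/-!
# Route `RamifiedHeegnerPair`, crux U₁ `LeafRankOneUpperAtThree` (stmt-BirchSwinnertonDyer-26022), line `partnerdescent` —
# the Hecke–Atkin–Lehner twist (HT) from the tree, part 4: the `ℓ` forward Hermite forms `H_t = (1, 0; ℓ^e t, ℓ)` of the local
# Eichler order of level `ℓ^e` (`p`-adic `2 × 2` bookkeeping only)

HONEST FRAMING. Theorems only; helper file (`--supports stmt-BirchSwinnertonDyer-26022`); pure `p`-adic linear algebra over `ℚ_ℓ`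
(no quaternion algebra, no named fact, no `sorry`); nothing booked; BSD is proved for no curve. Lead prover bsd-line-rhp-p2 g65,
2026-08-31.

WHAT. In the local Eichler order `O_ℓ = (ℤ_ℓ ℤ_ℓ; ℓ^e ℤ_ℓ ℤ_ℓ)` (`AtkinLehner.IsLevelShape e`, ‹EichlerOrderAtkinLehnerIdeal›), `e ≥ 1`, the
right ideals `z O_ℓ` of index `ℓ²` (`‖det z‖ = ℓ⁻¹`) which are FORWARD (`‖z₀₀‖ = 1`, part 3) are exactly the `ℓ` ideals `H_t O_ℓ`,
`H_t = (1, 0; ℓ^e t, ℓ)`, `0 ≤ t < ℓ` — the module docstring of ‹BrandtEichlerLevelUOperators› («`ℓ` forward ones»), i.e.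
Bertolini–Darmon's «`U_p(e) = {e' : source(e') = target(e)}`» has `ℓ` elements. Here, robust under the approximation `A ≈ H_t`
(mod `ℓ^{e+1}`) needed to realise `H_t` in a dense subalgebra:
* `hermiteFwd_shape` — `A ≈ H_t` is level-shaped with `‖A₀₀‖ = 1`, `‖det A‖ = ℓ⁻¹`;
* `isLevelShape_inv_of_norm_det_eq_one` — a level-shaped matrix with unit determinant has a level-shaped inverse;
* `not_isLevelShape_hermiteFwd_inv_mul` — for `s ≠ t` (`< ℓ`), `A ≈ H_s`, `B ≈ H_t`: `A⁻¹ B` is NOT level-shaped (distinct ideals);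
* `isLevelShape_hermiteFwd_inv_mul` — for `A ≈ H_t` and a forward `Z` of index `ℓ²` with `Z₁₀ ≡ ℓ^e t Z₀₀ (mod ℓ^{e+1})`: `A⁻¹ Z` is
  level-shaped with unit determinant (same ideal).
[cite: VignerasLNM800, Ch. II §2 Thm. 2.3 (3), Lemme 2.4] [cite: BertoliniDarmon2001, §4.1 pp. 142–144]
-/

set_option linter.dupNamespace false
set_option autoImplicit false

noncomputable section

namespace Summit.BirchSwinnertonDyer.BirchSwinnertonDyer.Theorems.LeafPartnerOrders

open Literature.NumberTheory.Automorphic Literature.NumberTheory.Automorphic.AtkinLehner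

variable {ℓ : ℕ} [hℓ : Fact ℓ.Prime] {e : ℕ}

/-! ### `p`-adic bookkeeping -/

/-- `0 < ℓ^{-n}`. [folklore] -/
private theorem zpow_neg_pos' (n : ℕ) : 0 < (ℓ : ℝ) ^ (-(n : ℤ)) := zpow_pos (by exact_mod_cast hℓ.out.pos) _

/-- `ℓ^{-n} ≤ 1`. [folklore] -/
theorem zpow_neg_le_one' (n : ℕ) : (ℓ : ℝ) ^ (-(n : ℤ)) ≤ 1 :=
  zpow_le_one_of_nonpos₀ (by exact_mod_cast hℓ.out.one_lt.le) (by omega)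

/-- `ℓ^{-m} ≤ ℓ^{-n}` for `n ≤ m`. [folklore] -/
theorem zpow_neg_le_zpow_neg {m n : ℕ} (h : n ≤ m) : (ℓ : ℝ) ^ (-(m : ℤ)) ≤ (ℓ : ℝ) ^ (-(n : ℤ)) :=
  zpow_le_zpow_right₀ (by exact_mod_cast hℓ.out.one_lt.le) (by omega)

/-- `ℓ^{-m} < ℓ^{-n}` for `n < m`. [folklore] -/
theorem zpow_neg_lt_zpow_neg {m n : ℕ} (h : n < m) : (ℓ : ℝ) ^ (-(m : ℤ)) < (ℓ : ℝ) ^ (-(n : ℤ)) :=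
  zpow_lt_zpow_right₀ (by exact_mod_cast hℓ.out.one_lt) (by omega)

/-- `‖ℓ^n‖ = ℓ^{-n}` in `ℚ_ℓ`. [folklore] -/
theorem norm_ell_pow (n : ℕ) : ‖(ℓ : ℚ_[ℓ]) ^ n‖ = (ℓ : ℝ) ^ (-(n : ℤ)) := by
  rw [norm_pow, Padic.norm_p, inv_pow, zpow_neg, zpow_natCast]

/-- `‖ℓ‖ = ℓ^{-1}`. [folklore] -/
theorem norm_ell : ‖(ℓ : ℚ_[ℓ])‖ = (ℓ : ℝ) ^ (-((1 : ℕ) : ℤ)) := by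
  rw [← norm_ell_pow 1, pow_one]

/-- `ℓ · ℓ^{-(n+1)} = ℓ^{-n}`. [folklore] -/
theorem ell_mul_zpow_neg_succ (n : ℕ) : (ℓ : ℝ) * (ℓ : ℝ) ^ (-((n + 1 : ℕ) : ℤ)) = (ℓ : ℝ) ^ (-(n : ℤ)) := by
  have hℓ0 : (ℓ : ℝ) ≠ 0 := by exact_mod_cast hℓ.out.ne_zero
  rw [show (-((n + 1 : ℕ) : ℤ)) = -(n : ℤ) + (-1) by push_cast; ring, zpow_add₀ hℓ0, zpow_neg_one,
    mul_comm, mul_assoc, inv_mul_cancel₀ hℓ0, mul_one]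

/-- `‖a b + c d‖ ≤ t` from `‖a‖‖b‖ ≤ t`, `‖c‖‖d‖ ≤ t`. [folklore] -/
theorem norm_add_mul_le' {a b c d : ℚ_[ℓ]} {t : ℝ} (h₁ : ‖a‖ * ‖b‖ ≤ t) (h₂ : ‖c‖ * ‖d‖ ≤ t) : ‖a * b + c * d‖ ≤ t :=
  (IsUltrametricDist.norm_add_le_max _ _).trans (max_le (by rw [norm_mul]; exact h₁) (by rw [norm_mul]; exact h₂))

/-- `‖x - y‖ ≤ max ‖x‖ ‖y‖` (ultrametric). [folklore] -/
theorem norm_sub_le_max' (x y : ℚ_[ℓ]) : ‖x - y‖ ≤ max ‖x‖ ‖y‖ := by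
  rw [sub_eq_add_neg, ← norm_neg y]; exact IsUltrametricDist.norm_add_le_max _ _

/-- `‖a b - c d‖ ≤ t` from `‖a‖‖b‖ ≤ t`, `‖c‖‖d‖ ≤ t`. [folklore] -/
theorem norm_sub_mul_le' {a b c d : ℚ_[ℓ]} {t : ℝ} (h₁ : ‖a‖ * ‖b‖ ≤ t) (h₂ : ‖c‖ * ‖d‖ ≤ t) : ‖a * b - c * d‖ ≤ t := by
  rw [sub_eq_add_neg, ← neg_mul]
  exact norm_add_mul_le' h₁ (by rw [norm_neg]; exact h₂)

/-- `‖x‖ ≤ s`, `‖y‖ ≤ t`, `s, t ≥ 0`-free form: `‖x y‖ ≤ s t`. [folklore] -/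
theorem norm_mul_le_mul' {x y : ℚ_[ℓ]} {s t : ℝ} (hx : ‖x‖ ≤ s) (hy : ‖y‖ ≤ t) : ‖x * y‖ ≤ s * t := by
  rw [norm_mul]; exact mul_le_mul hx hy (norm_nonneg _) ((norm_nonneg _).trans hx)

/-- A natural number has `ℓ`-adic norm `≤ 1`. [folklore] -/
theorem norm_natCast_le_one' (t : ℕ) : ‖(t : ℚ_[ℓ])‖ ≤ 1 := by
  have := Padic.norm_int_le_one (p := ℓ) (t : ℤ)
  simpa using this

/-- Distinct residues: for `s ≠ t` below `ℓ`, `‖t - s‖ = 1` in `ℚ_ℓ`. [folklore] -/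
theorem norm_natCast_sub_natCast_eq_one {s t : ℕ} (hs : s < ℓ) (ht : t < ℓ) (hst : s ≠ t) :
    ‖((t : ℚ_[ℓ]) - (s : ℚ_[ℓ]))‖ = 1 := by
  have h1 : ‖(((t : ℤ) - (s : ℤ) : ℤ) : ℚ_[ℓ])‖ ≤ 1 := Padic.norm_int_le_one _
  have h2 : ¬ ‖(((t : ℤ) - (s : ℤ) : ℤ) : ℚ_[ℓ])‖ < 1 := by
    rw [Padic.norm_intCast_lt_one_iff]
    intro hdvd
    have habs : |((t : ℤ) - (s : ℤ))| < (ℓ : ℤ) := by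
      rw [abs_sub_lt_iff]; constructor <;> omega
    have hne : ((t : ℤ) - (s : ℤ)) ≠ 0 := by omega
    exact hne (Int.eq_zero_of_abs_lt_dvd hdvd habs)
  have h : ‖(((t : ℤ) - (s : ℤ) : ℤ) : ℚ_[ℓ])‖ = 1 := le_antisymm h1 (not_lt.mp h2)
  simpa using h

/-! ### The forward Hermite forms `H_t = (1, 0; ℓ^e t, ℓ)` up to `ℓ^{-(e+1)}` -/

/-- **`A ≈ H_t` is a forward generator of index `ℓ²`**: if `‖A - (1, 0; ℓ^e t, ℓ)‖ ≤ ℓ^{-(e+1)}` entrywise (`e ≥ 1`, `t ∈ ℕ`) then `A` is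
level-shaped of level `ℓ^e`, `‖A₀₀‖ = 1` and `‖det A‖ = ℓ⁻¹`. [cite: VignerasLNM800, Ch. II §2 Thm. 2.3 (3)] -/
theorem hermiteFwd_shape (he : 1 ≤ e) (t : ℕ) {A : Matrix (Fin 2) (Fin 2) ℚ_[ℓ]}
    (hA : ∀ i j, ‖(A - !![1, 0; (ℓ : ℚ_[ℓ]) ^ e * t, ℓ]) i j‖ ≤ (ℓ : ℝ) ^ (-((e + 1 : ℕ) : ℤ))) :
    IsLevelShape e A ∧ ‖A 0 0‖ = 1 ∧ ‖A.det‖ = (ℓ : ℝ) ^ (-((1 : ℕ) : ℤ)) := by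
  set r := (ℓ : ℝ) ^ (-(e : ℤ))
  set r' := (ℓ : ℝ) ^ (-((e + 1 : ℕ) : ℤ))
  set Δ := A - !![1, 0; (ℓ : ℚ_[ℓ]) ^ e * t, ℓ] with hΔ
  have hr'r : r' ≤ r := zpow_neg_le_zpow_neg (by omega)
  have hr'1 : r' ≤ 1 := zpow_neg_le_one' _
  have hr1 : r ≤ 1 := zpow_neg_le_one' _
  have hr'ℓ : r' < (ℓ : ℝ) ^ (-((1 : ℕ) : ℤ)) := zpow_neg_lt_zpow_neg (by omega)
  have hrℓ : r ≤ (ℓ : ℝ) ^ (-((1 : ℕ) : ℤ)) := zpow_neg_le_zpow_neg he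
  have h00 : A 0 0 = 1 + Δ 0 0 := by simp [hΔ]
  have h01 : A 0 1 = Δ 0 1 := by simp [hΔ]
  have h10 : A 1 0 = (ℓ : ℚ_[ℓ]) ^ e * t + Δ 1 0 := by simp [hΔ]
  have h11 : A 1 1 = ℓ + Δ 1 1 := by simp [hΔ]
  have hn00 : ‖A 0 0‖ = 1 := by
    rw [h00, IsUltrametricDist.norm_add_eq_max_of_norm_ne_norm, norm_one, max_eq_left ((hA 0 0).trans hr'1)]
    rw [norm_one]; exact (lt_of_le_of_lt (hA 0 0) (hr'ℓ.trans_le (zpow_neg_le_one' 1) |>.trans_le le_rfl)).ne'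
  have hn10 : ‖A 1 0‖ ≤ r := by
    rw [h10]
    refine (IsUltrametricDist.norm_add_le_max _ _).trans (max_le ?_ ((hA 1 0).trans hr'r))
    rw [norm_mul, norm_ell_pow]
    exact (mul_le_mul_of_nonneg_left (norm_natCast_le_one' t) (zpow_neg_pos' e).le).trans (mul_one r).le
  have hn11 : ‖A 1 1‖ ≤ (ℓ : ℝ) ^ (-((1 : ℕ) : ℤ)) := by
    rw [h11]
    exact (IsUltrametricDist.norm_add_le_max _ _).trans (max_le norm_ell.le ((hA 1 1).trans hr'ℓ.le))
  refine ⟨⟨fun i j ↦ ?_, hn10⟩, hn00, ?_⟩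
  · fin_cases i <;> fin_cases j
    · exact hn00.le
    · simp only [Fin.zero_eta, Fin.isValue, Fin.mk_one]; rw [h01]; exact (hA 0 1).trans hr'1
    · exact hn10.trans hr1
    · exact hn11.trans (zpow_neg_le_one' 1)
  · -- `det A = ℓ + E` with `‖E‖ ≤ ℓ^{-(e+1)} < ℓ^{-1} = ‖ℓ‖`
    rw [Matrix.det_fin_two, h00, h01, h10, h11]
    have e1 : (1 + Δ 0 0) * (↑ℓ + Δ 1 1) - Δ 0 1 * ((ℓ : ℚ_[ℓ]) ^ e * t + Δ 1 0) =
        ℓ + ((Δ 0 0 * (ℓ + Δ 1 1) + 1 * Δ 1 1) - Δ 0 1 * ((ℓ : ℚ_[ℓ]) ^ e * t + Δ 1 0)) := by ring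
    have hE : ‖(Δ 0 0 * (ℓ + Δ 1 1) + 1 * Δ 1 1) - Δ 0 1 * ((ℓ : ℚ_[ℓ]) ^ e * t + Δ 1 0)‖ ≤ r' := by
      refine (norm_sub_le_max' _ _).trans (max_le ?_ ?_)
      · refine norm_add_mul_le' ?_ ?_
        · exact (mul_le_mul (hA 0 0) (by rw [← h11]; exact hn11.trans (zpow_neg_le_one' 1)) (norm_nonneg _)
            (zpow_neg_pos' _).le).trans (mul_one r').le
        · rw [norm_one, one_mul]; exact hA 1 1
      · rw [← h10]
        exact (norm_mul_le_mul' (hA 0 1) (hn10.trans hr1)).trans (mul_one r').le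
    rw [e1, IsUltrametricDist.norm_add_eq_max_of_norm_ne_norm, norm_ell, max_eq_left (hE.trans hr'ℓ.le)]
    rw [norm_ell]
    exact ((hE.trans_lt hr'ℓ).ne).symm

/-- **A level-shaped matrix with unit determinant has a level-shaped inverse** (`O_ℓˣ` is a group): `W⁻¹ = (det W)⁻¹ adj(W)` and
`adj(W)₁₀ = -W₁₀`. [folklore] -/
theorem isLevelShape_inv_of_norm_det_eq_one {W : Matrix (Fin 2) (Fin 2) ℚ_[ℓ]} (hW : IsLevelShape e W) (hdet : ‖W.det‖ = 1) :
    IsLevelShape e W⁻¹ := by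
  have hd0 : W.det ≠ 0 := fun h ↦ by rw [h, norm_zero] at hdet; exact zero_ne_one hdet
  have key : ∀ i j, ‖W⁻¹ i j‖ = ‖W.adjugate i j‖ := fun i j ↦ by
    rw [Matrix.inv_def, Ring.inverse_eq_inv', Matrix.smul_apply, smul_eq_mul, norm_mul, norm_inv, hdet, inv_one, one_mul]
  obtain ⟨hint, h10⟩ := hW
  refine ⟨fun i j ↦ ?_, ?_⟩
  · rw [key, Matrix.adjugate_fin_two]
    fin_cases i <;> fin_cases j <;> simp [hint]
  · rw [key, Matrix.adjugate_fin_two]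
    simpa using h10

/-- The `(1,0)` entry of `adj(A) B` for `2 × 2` matrices: `-A₁₀ B₀₀ + A₀₀ B₁₀`. [folklore] -/
theorem adjugate_mul_apply_one_zero (A B : Matrix (Fin 2) (Fin 2) ℚ_[ℓ]) :
    (A.adjugate * B) 1 0 = -A 1 0 * B 0 0 + A 0 0 * B 1 0 := by
  rw [Matrix.adjugate_fin_two, Matrix.mul_apply, Fin.sum_univ_two]
  simp

/-- The `(0,0)` entry of `adj(A) B`: `A₁₁ B₀₀ - A₀₁ B₁₀`. [folklore] -/
theorem adjugate_mul_apply_zero_zero (A B : Matrix (Fin 2) (Fin 2) ℚ_[ℓ]) :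
    (A.adjugate * B) 0 0 = A 1 1 * B 0 0 - A 0 1 * B 1 0 := by
  rw [Matrix.adjugate_fin_two, Matrix.mul_apply, Fin.sum_univ_two]
  simp; ring

/-- The `(0,1)` entry of `adj(A) B`: `A₁₁ B₀₁ - A₀₁ B₁₁`. [folklore] -/
theorem adjugate_mul_apply_zero_one (A B : Matrix (Fin 2) (Fin 2) ℚ_[ℓ]) :
    (A.adjugate * B) 0 1 = A 1 1 * B 0 1 - A 0 1 * B 1 1 := by
  rw [Matrix.adjugate_fin_two, Matrix.mul_apply, Fin.sum_univ_two]
  simp; ring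

/-- The `(1,1)` entry of `adj(A) B`: `-A₁₀ B₀₁ + A₀₀ B₁₁`. [folklore] -/
theorem adjugate_mul_apply_one_one (A B : Matrix (Fin 2) (Fin 2) ℚ_[ℓ]) :
    (A.adjugate * B) 1 1 = -A 1 0 * B 0 1 + A 0 0 * B 1 1 := by
  rw [Matrix.adjugate_fin_two, Matrix.mul_apply, Fin.sum_univ_two]
  simp

/-- Entries of `A⁻¹ B` have norm `‖det A‖⁻¹ · ‖(adj(A) B) i j‖`. [folklore] -/
theorem norm_inv_mul_apply (A B : Matrix (Fin 2) (Fin 2) ℚ_[ℓ]) (i j : Fin 2) :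
    ‖(A⁻¹ * B) i j‖ = ‖A.det‖⁻¹ * ‖(A.adjugate * B) i j‖ := by
  rw [Matrix.inv_def, Ring.inverse_eq_inv', Matrix.smul_mul, Matrix.smul_apply, smul_eq_mul, norm_mul, norm_inv]

/-- **Distinct forward Hermite forms generate distinct ideals**: for `s ≠ t` below `ℓ` and `A ≈ H_s`, `B ≈ H_t` (mod `ℓ^{e+1}`, `e ≥ 1`),
`A⁻¹ B` is not level-shaped — its `(1,0)` entry has norm `ℓ^{1-e} > ℓ^{-e}`. [cite: VignerasLNM800, Ch. II §2 Thm. 2.3 (3)] -/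
theorem not_isLevelShape_hermiteFwd_inv_mul (he : 1 ≤ e) {s t : ℕ} (hs : s < ℓ) (ht : t < ℓ) (hst : s ≠ t)
    {A B : Matrix (Fin 2) (Fin 2) ℚ_[ℓ]}
    (hA : ∀ i j, ‖(A - !![1, 0; (ℓ : ℚ_[ℓ]) ^ e * s, ℓ]) i j‖ ≤ (ℓ : ℝ) ^ (-((e + 1 : ℕ) : ℤ)))
    (hB : ∀ i j, ‖(B - !![1, 0; (ℓ : ℚ_[ℓ]) ^ e * t, ℓ]) i j‖ ≤ (ℓ : ℝ) ^ (-((e + 1 : ℕ) : ℤ))) :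
    ¬ IsLevelShape e (A⁻¹ * B) := by
  set r := (ℓ : ℝ) ^ (-(e : ℤ))
  set r' := (ℓ : ℝ) ^ (-((e + 1 : ℕ) : ℤ))
  set α := A - !![1, 0; (ℓ : ℚ_[ℓ]) ^ e * s, ℓ] with hα
  set β := B - !![1, 0; (ℓ : ℚ_[ℓ]) ^ e * t, ℓ] with hβ
  have hr'r : r' < r := zpow_neg_lt_zpow_neg (by omega)
  have hr'1 : r' ≤ 1 := zpow_neg_le_one' _
  have hr1 : r ≤ 1 := zpow_neg_le_one' _
  obtain ⟨-, -, hdetA⟩ := hermiteFwd_shape he s hA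
  have hdA0 : A.det ≠ 0 := fun h ↦ by rw [h, norm_zero] at hdetA; exact (zpow_neg_pos' 1).ne hdetA
  have hA00 : A 0 0 = 1 + α 0 0 := by simp [hα]
  have hA10 : A 1 0 = (ℓ : ℚ_[ℓ]) ^ e * s + α 1 0 := by simp [hα]
  have hB00 : B 0 0 = 1 + β 0 0 := by simp [hβ]
  have hB10 : B 1 0 = (ℓ : ℚ_[ℓ]) ^ e * t + β 1 0 := by simp [hβ]
  -- the main term `ℓ^e (t - s)` and the error
  have e1 : -A 1 0 * B 0 0 + A 0 0 * B 1 0 = (ℓ : ℚ_[ℓ]) ^ e * ((t : ℚ_[ℓ]) - s) +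
      ((α 0 0 * ((ℓ : ℚ_[ℓ]) ^ e * t) + (1 + α 0 0) * β 1 0) - (((ℓ : ℚ_[ℓ]) ^ e * s) * β 0 0 + α 1 0 * (1 + β 0 0))) := by
    rw [hA00, hA10, hB00, hB10]; ring
  have hmain : ‖(ℓ : ℚ_[ℓ]) ^ e * ((t : ℚ_[ℓ]) - s)‖ = r := by
    rw [norm_mul, norm_ell_pow, norm_natCast_sub_natCast_eq_one hs ht hst, mul_one]
  have hℓes : ‖(ℓ : ℚ_[ℓ]) ^ e * s‖ ≤ r := by
    rw [norm_mul, norm_ell_pow]; exact (mul_le_mul_of_nonneg_left (norm_natCast_le_one' s) (zpow_neg_pos' e).le).trans (mul_one r).le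
  have hℓet : ‖(ℓ : ℚ_[ℓ]) ^ e * t‖ ≤ r := by
    rw [norm_mul, norm_ell_pow]; exact (mul_le_mul_of_nonneg_left (norm_natCast_le_one' t) (zpow_neg_pos' e).le).trans (mul_one r).le
  have h1a : ‖1 + α 0 0‖ ≤ 1 := (IsUltrametricDist.norm_add_le_max _ _).trans (max_le (by rw [norm_one]) ((hA 0 0).trans hr'1))
  have h1b : ‖1 + β 0 0‖ ≤ 1 := (IsUltrametricDist.norm_add_le_max _ _).trans (max_le (by rw [norm_one]) ((hB 0 0).trans hr'1))
  have herr : ‖(α 0 0 * ((ℓ : ℚ_[ℓ]) ^ e * t) + (1 + α 0 0) * β 1 0) - (((ℓ : ℚ_[ℓ]) ^ e * s) * β 0 0 + α 1 0 * (1 + β 0 0))‖ ≤ r' := by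
    refine (norm_sub_le_max' _ _).trans (max_le ?_ ?_)
    · exact norm_add_mul_le' ((mul_le_mul (hA 0 0) hℓet (norm_nonneg _) (zpow_neg_pos' _).le).trans
          (mul_le_of_le_one_right (zpow_neg_pos' _).le hr1))
        ((mul_le_mul h1a (hB 1 0) (norm_nonneg _) zero_le_one).trans (one_mul r').le)
    · exact norm_add_mul_le' ((mul_le_mul hℓes (hB 0 0) (norm_nonneg _) (zpow_neg_pos' e).le).trans (mul_le_of_le_one_left (zpow_neg_pos' _).le hr1))
        ((mul_le_mul (hA 1 0) h1b (norm_nonneg _) (zpow_neg_pos' _).le).trans (mul_one r').le)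
  have hsum : ‖-A 1 0 * B 0 0 + A 0 0 * B 1 0‖ = r := by
    rw [e1, IsUltrametricDist.norm_add_eq_max_of_norm_ne_norm, hmain, max_eq_left (herr.trans hr'r.le)]
    rw [hmain]; exact ((herr.trans_lt hr'r).ne).symm
  -- the `(1,0)` entry of `A⁻¹ B` has norm `ℓ · r > r`
  intro hshape
  have h := hshape.2
  rw [norm_inv_mul_apply A B, adjugate_mul_apply_one_zero, hsum, hdetA, ← zpow_neg, neg_neg] at h
  have : (ℓ : ℝ) ^ ((1 : ℕ) : ℤ) * r ≤ 1 * r := by rwa [one_mul]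
  have h2 := le_of_mul_le_mul_right this (zpow_neg_pos' e)
  have h3 : (1 : ℝ) < (ℓ : ℝ) ^ ((1 : ℕ) : ℤ) := by
    rw [Nat.cast_one, zpow_one]; exact_mod_cast hℓ.out.one_lt
  exact absurd h2 (not_le.mpr h3)

/-- **The forward Hermite form of a forward generator.** Let `A ≈ H_t` (mod `ℓ^{e+1}`, `e ≥ 1`) and let `Z` be level-shaped with
`‖Z₀₀‖ = 1`, `‖det Z‖ = ℓ⁻¹` and `‖Z₁₀ - ℓ^e t Z₀₀‖ ≤ ℓ^{-(e+1)}`. Then `A⁻¹ Z` is level-shaped with `‖det(A⁻¹ Z)‖ = 1` (so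
`Z O_ℓ = H_t O_ℓ`). [cite: VignerasLNM800, Ch. II §2 Thm. 2.3 (3)] -/
theorem isLevelShape_hermiteFwd_inv_mul (he : 1 ≤ e) (t : ℕ) {A Z : Matrix (Fin 2) (Fin 2) ℚ_[ℓ]}
    (hA : ∀ i j, ‖(A - !![1, 0; (ℓ : ℚ_[ℓ]) ^ e * t, ℓ]) i j‖ ≤ (ℓ : ℝ) ^ (-((e + 1 : ℕ) : ℤ)))
    (hZ : IsLevelShape e Z) (hZ00 : ‖Z 0 0‖ = 1) (hZdet : ‖Z.det‖ = (ℓ : ℝ) ^ (-((1 : ℕ) : ℤ)))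
    (hZt : ‖Z 1 0 - (ℓ : ℚ_[ℓ]) ^ e * t * Z 0 0‖ ≤ (ℓ : ℝ) ^ (-((e + 1 : ℕ) : ℤ))) :
    IsLevelShape e (A⁻¹ * Z) ∧ ‖(A⁻¹ * Z).det‖ = 1 := by
  set r := (ℓ : ℝ) ^ (-(e : ℤ))
  set r' := (ℓ : ℝ) ^ (-((e + 1 : ℕ) : ℤ))
  set r₁ := (ℓ : ℝ) ^ (-((1 : ℕ) : ℤ))
  set Δ := A - !![1, 0; (ℓ : ℚ_[ℓ]) ^ e * t, ℓ] with hΔ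
  have hℓ0 : (ℓ : ℝ) ≠ 0 := by exact_mod_cast hℓ.out.ne_zero
  have hr'r : r' ≤ r := zpow_neg_le_zpow_neg (by omega)
  have hr'1 : r' ≤ 1 := zpow_neg_le_one' _
  have hr1 : r ≤ 1 := zpow_neg_le_one' _
  have hr₁1 : r₁ ≤ 1 := zpow_neg_le_one' _
  have hrr₁ : r ≤ r₁ := zpow_neg_le_zpow_neg he
  have hr'r₁ : r' ≤ r₁ := zpow_neg_le_zpow_neg (by omega)
  obtain ⟨-, -, hdetA⟩ := hermiteFwd_shape he t hA
  have hdA0 : A.det ≠ 0 := fun h ↦ by rw [h, norm_zero] at hdetA; exact (zpow_neg_pos' 1).ne hdetA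
  obtain ⟨hZint, hZ10⟩ := hZ
  have hA00 : A 0 0 = 1 + Δ 0 0 := by simp [hΔ]
  have hA01 : A 0 1 = Δ 0 1 := by simp [hΔ]
  have hA10 : A 1 0 = (ℓ : ℚ_[ℓ]) ^ e * t + Δ 1 0 := by simp [hΔ]
  have hA11 : A 1 1 = ℓ + Δ 1 1 := by simp [hΔ]
  have h1a : ‖1 + Δ 0 0‖ ≤ 1 := (IsUltrametricDist.norm_add_le_max _ _).trans (max_le (by rw [norm_one]) ((hA 0 0).trans hr'1))
  have hℓa : ‖(ℓ : ℚ_[ℓ]) + Δ 1 1‖ ≤ r₁ := (IsUltrametricDist.norm_add_le_max _ _).trans (max_le norm_ell.le ((hA 1 1).trans hr'r₁))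
  have hℓet : ‖(ℓ : ℚ_[ℓ]) ^ e * t‖ ≤ r := by
    rw [norm_mul, norm_ell_pow]; exact (mul_le_mul_of_nonneg_left (norm_natCast_le_one' t) (zpow_neg_pos' e).le).trans (mul_one r).le
  -- `‖Z₁₁‖ ≤ ℓ⁻¹`: from `Z₀₀ Z₁₁ = det Z + Z₀₁ Z₁₀`
  have hZ11 : ‖Z 1 1‖ ≤ r₁ := by
    have e1 : Z 1 1 = (Z 0 0)⁻¹ * (Z.det + Z 0 1 * Z 1 0) := by
      have h0 : Z 0 0 ≠ 0 := fun h ↦ by rw [h, norm_zero] at hZ00; exact zero_ne_one hZ00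
      rw [Matrix.det_fin_two]; field_simp; ring
    rw [e1, norm_mul, norm_inv, hZ00, inv_one, one_mul]
    exact (IsUltrametricDist.norm_add_le_max _ _).trans (max_le hZdet.le ((norm_mul_le_mul' (hZint 0 1) hZ10).trans
      (by rw [one_mul]; exact hrr₁)))
  -- the four entries of `adj(A) Z`
  have hM00 : ‖(A.adjugate * Z) 0 0‖ ≤ r₁ := by
    rw [adjugate_mul_apply_zero_zero, hA11, hA01]
    exact norm_sub_mul_le' ((mul_le_mul hℓa (hZint 0 0) (norm_nonneg _) (zpow_neg_pos' 1).le).trans (mul_one r₁).le)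
      ((mul_le_mul (hA 0 1) (hZ10.trans hr1) (norm_nonneg _) (zpow_neg_pos' _).le).trans (by rw [mul_one]; exact hr'r₁))
  have hM01 : ‖(A.adjugate * Z) 0 1‖ ≤ r₁ := by
    rw [adjugate_mul_apply_zero_one, hA11, hA01]
    exact norm_sub_mul_le' ((mul_le_mul hℓa (hZint 0 1) (norm_nonneg _) (zpow_neg_pos' 1).le).trans (mul_one r₁).le)
      ((mul_le_mul (hA 0 1) (hZint 1 1) (norm_nonneg _) (zpow_neg_pos' _).le).trans (by rw [mul_one]; exact hr'r₁))
  have hM10 : ‖(A.adjugate * Z) 1 0‖ ≤ r' := by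
    rw [adjugate_mul_apply_one_zero, hA10, hA00]
    have e1 : -((ℓ : ℚ_[ℓ]) ^ e * t + Δ 1 0) * Z 0 0 + (1 + Δ 0 0) * Z 1 0 =
        (Z 1 0 - (ℓ : ℚ_[ℓ]) ^ e * t * Z 0 0) + (Δ 0 0 * Z 1 0 - Δ 1 0 * Z 0 0) := by ring
    rw [e1]
    refine (IsUltrametricDist.norm_add_le_max _ _).trans (max_le hZt ?_)
    exact norm_sub_mul_le' ((mul_le_mul (hA 0 0) (hZ10.trans hr1) (norm_nonneg _) (zpow_neg_pos' _).le).trans (mul_one r').le)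
      ((mul_le_mul (hA 1 0) (hZint 0 0) (norm_nonneg _) (zpow_neg_pos' _).le).trans (mul_one r').le)
  have hM11 : ‖(A.adjugate * Z) 1 1‖ ≤ r₁ := by
    rw [adjugate_mul_apply_one_one, hA10, hA00]
    have e1 : -((ℓ : ℚ_[ℓ]) ^ e * t + Δ 1 0) * Z 0 1 + (1 + Δ 0 0) * Z 1 1 =
        ((1 + Δ 0 0) * Z 1 1 - ((ℓ : ℚ_[ℓ]) ^ e * t) * Z 0 1) + -(Δ 1 0 * Z 0 1) := by ring
    rw [e1]
    refine (IsUltrametricDist.norm_add_le_max _ _).trans (max_le ?_ ?_)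
    · exact norm_sub_mul_le' ((mul_le_mul h1a hZ11 (norm_nonneg _) zero_le_one).trans (one_mul r₁).le)
        ((mul_le_mul hℓet (hZint 0 1) (norm_nonneg _) (zpow_neg_pos' e).le).trans (by rw [mul_one]; exact hrr₁))
    · rw [norm_neg]
      exact (norm_mul_le_mul' (hA 1 0) (hZint 0 1)).trans (by rw [mul_one]; exact hr'r₁)
  -- divide by `det A`, of norm `ℓ⁻¹`
  have hdinv : ‖A.det‖⁻¹ = (ℓ : ℝ) := by rw [hdetA, ← zpow_neg, neg_neg, Nat.cast_one, zpow_one]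
  have hℓr₁ : (ℓ : ℝ) * r₁ = 1 := by
    show (ℓ : ℝ) * (ℓ : ℝ) ^ (-((1 : ℕ) : ℤ)) = 1
    rw [Nat.cast_one, zpow_neg_one, mul_inv_cancel₀ hℓ0]
  have hℓr' : (ℓ : ℝ) * r' = r := ell_mul_zpow_neg_succ e
  refine ⟨⟨fun i j ↦ ?_, ?_⟩, ?_⟩
  · rw [norm_inv_mul_apply A Z, hdinv]
    fin_cases i <;> fin_cases j
    · exact (mul_le_mul_of_nonneg_left hM00 (Nat.cast_nonneg ℓ)).trans hℓr₁.le
    · exact (mul_le_mul_of_nonneg_left hM01 (Nat.cast_nonneg ℓ)).trans hℓr₁.le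
    · exact (mul_le_mul_of_nonneg_left hM10 (Nat.cast_nonneg ℓ)).trans (hℓr'.le.trans hr1)
    · exact (mul_le_mul_of_nonneg_left hM11 (Nat.cast_nonneg ℓ)).trans hℓr₁.le
  · rw [norm_inv_mul_apply A Z, hdinv]
    exact (mul_le_mul_of_nonneg_left hM10 (Nat.cast_nonneg ℓ)).trans hℓr'.le
  · rw [Matrix.det_mul, Matrix.det_nonsing_inv, Ring.inverse_eq_inv', norm_mul, norm_inv, hdinv, hZdet]
    exact hℓr₁

end Summit.BirchSwinnertonDyer.BirchSwinnertonDyer.Theorems.LeafPartnerOrders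

end
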